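import Summits.NavierStokesRegularity.NavierStokesRegularity.Theorems.EfficiencyFloorProductionEfficiencyDecayTypeIStratum
import Literature.Analysis.FluidPDE.TsaiProfileL103
import HarnessLib

/-!
# Crux `EfficiencyFloor.ProductionEfficiencyDecay` (stmt-NavierStokesRegularity-22866): the BKM-currency criterion —
# the pointwise crux holds along every blow-up whose vorticity maximum is `o(Z²)` (`‖curl u(t)‖_∞ ≪ ‖curl u(t)‖₂⁴`)

Helper file (`--supports stmt-NavierStokesRegularity-22866`; line `efficiency_floor`; companion of
`…ProductionEfficiencyDecayTypeIStratum` (p829334/p829398) and `…GradientCriterion`). No registered stub and no crux is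
closed here.

The stretching term of the registered budget triple is controlled by the VORTICITY MAXIMUM alone:
`S = ∫⟪ω, ∇u ω⟫ ≤ ‖ω‖_∞ ∫‖∇u‖·|ω| ≤ ‖ω‖_∞ · ½(∫‖∇u‖² + ∫|ω|²) ≤ ‖ω‖_∞ · Z` (operator norm ≤ Frobenius norm,
`opNorm_sq_le_frobeniusNormSq_fin3`, and the whole-space `div`–`curl` bound `∫|∇u|²_F ≤ ∫|curl u|²`,
`lintegral_frobeniusNormSq_fderiv_le_lintegral_sq_norm_curl`). Hence (`Ż = 2S − 2ν·Pal ≤ 2‖ω‖_∞ Z`):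

* `stretching_le_of_norm_curl_le` (one instant): `∫⟪curl v, ∇v (curl v)⟫ ≤ W ∫‖curl v‖²` whenever `|curl v| ≤ W`,
  for divergence-free `C²` fields with `v, Dv ∈ L²`;
* `depletion_of_curl_small` (ONE solution, registered-stub currency): if for every `δ > 0`, eventually as `t ↑ T`,
  `‖curl u(t,x)‖ ≤ δ·Z(t)²` for all `x` (`Z(t) = (∫⁻‖curl u(t)‖ₑ²).toReal`) — i.e. `‖ω(t)‖_∞ = o(‖ω(t)‖₂⁴)` — then every
  budget triple satisfies, for every `ε > 0`, eventually `0 < Z ∧ 2S − 2ν·Pal ≤ ε Z³` (the conclusion of the registered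
  crux-proper stub `stub_depletionGivenBudget` for this solution);
* `efficiencyDecayLaw_of_curl_small` (crux currency), and BY NAME `stub_depletionGivenBudget_of_curl_small`,
  `productionEfficiencyDecay_of_curl_small`;
* `curl_small_of_fderiv_small` (the gradient criterion of `…GradientCriterion` implies this one, `|curl v| ≤ ‖curlCLM‖‖∇v‖`)
  and `curl_small_of_isTypeIBlowup_of_floor` (velocity Type I + super-Leray floor ⟹ the vorticity criterion, by the
  landed KNSS vorticity rate), so both earlier files factor through this one.

READING. `‖ω‖_∞/Z²` has the dimension of `ν⁻³`; for a single-scale structure of vorticity `Ω` and size `L`,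
`Z ∼ Ω²L³` and the criterion `‖ω‖_∞ ≪ Z²` reads `Ω L² ≫ ν`, i.e. the local Reynolds number of the collapsing structure
diverges — self-similar (Type-I) scaling `Ω ∼ (T−t)⁻¹, L ∼ √(T−t)` is exactly borderline, where `…TypeIStratum` shows
the crux is equivalent to the super-Leray floor (heuristic remark; nothing is claimed about actual blow-ups). HONEST
FRAMING: a sufficient condition for an OPEN statement about HYPOTHETICAL blow-ups; stmt-22866 and Navier–Stokes
regularity are NOT proved; no registered stub or crux is closed; no summit statement is proved. [folklore]
-/

-- the problem directory repeats the summit name (`NavierStokesRegularity/NavierStokesRegularity`)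
set_option linter.dupNamespace false

noncomputable section

open Set Filter MeasureTheory Topology Function
open scoped InnerProductSpace ENNReal NNReal ContDiff
open Literature.Analysis.FluidPDE

namespace Summit.NavierStokesRegularity.NavierStokesRegularity.Theorems

namespace ProductionEfficiencyDecay

namespace VorticityCriterion

/-! ### §1 One instant: the stretching term against the vorticity maximum -/

/-- **`S ≤ ‖curl v‖_∞ · Z` at one instant.** For a divergence-free `C²` field `v : ℝ³ → ℝ³` with `v, Dv ∈ L²` and
`|curl v(x)| ≤ W` everywhere: `∫⟪curl v, ∇v (curl v)⟫ ≤ W ∫‖curl v‖²` (pointwise `⟪ω, ∇v ω⟫ ≤ W ‖∇v‖ |ω| ≤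
W (‖∇v‖² + |ω|²)/2`, operator norm `≤` Frobenius norm, and `∫|∇v|²_F ≤ ∫|curl v|²` on the whole space). [folklore] -/
theorem stretching_le_of_norm_curl_le {v : EuclideanSpace ℝ (Fin 3) → EuclideanSpace ℝ (Fin 3)}
    (hv : ContDiff ℝ 2 v) (hdiv : VectorCalculus.IsDivFree v) (h0 : ∫⁻ x, ‖v x‖ₑ ^ 2 < ⊤)
    (h1 : ∫⁻ x, ‖iteratedFDeriv ℝ 1 v x‖ₑ ^ 2 < ⊤) {W : ℝ} (hW : ∀ x, ‖curl v x‖ ≤ W) :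
    ∫ x, ⟪curl v x, fderiv ℝ v x (curl v x)⟫_ℝ ≤ W * ∫ x, ‖curl v x‖ ^ 2 := by
  have hint : Integrable (fun x => ‖curl v x‖ ^ 2) := (integrable_norm_curl_sq hv h1).1
  have hv1 : ContDiff ℝ 1 v := hv.of_le (by norm_cast)
  have hgc : Continuous (iteratedFDeriv ℝ 1 v) := hv.continuous_iteratedFDeriv (by norm_cast)
  have hg : Integrable fun x => ‖iteratedFDeriv ℝ 1 v x‖ ^ 2 := integrable_sq_norm_of_lintegral_lt_top hgc h1
  have hωc : Continuous (curl v) := continuous_curl hv1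
  have hDc : Continuous (fderiv ℝ v) := hv1.continuous_fderiv one_ne_zero
  have hfc : Continuous fun x => ⟪curl v x, fderiv ℝ v x (curl v x)⟫_ℝ :=
    hωc.inner (hDc.clm_apply hωc)
  have hW0 : 0 ≤ W := (norm_nonneg _).trans (hW 0)
  -- pointwise bound by `W/2 · (‖Dv‖² + |ω|²)`
  have hpt_abs : ∀ x, |⟪curl v x, fderiv ℝ v x (curl v x)⟫_ℝ| ≤
      W / 2 * (‖iteratedFDeriv ℝ 1 v x‖ ^ 2 + ‖curl v x‖ ^ 2) := by
    intro x
    have hA : ‖fderiv ℝ v x (curl v x)‖ ≤ ‖iteratedFDeriv ℝ 1 v x‖ * ‖curl v x‖ := by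
      rw [norm_iteratedFDeriv_one]; exact ContinuousLinearMap.le_opNorm _ _
    have h2 : ‖iteratedFDeriv ℝ 1 v x‖ * ‖curl v x‖ ≤
        (‖iteratedFDeriv ℝ 1 v x‖ ^ 2 + ‖curl v x‖ ^ 2) / 2 := by
      nlinarith [sq_nonneg (‖iteratedFDeriv ℝ 1 v x‖ - ‖curl v x‖)]
    calc |⟪curl v x, fderiv ℝ v x (curl v x)⟫_ℝ| ≤ ‖curl v x‖ * ‖fderiv ℝ v x (curl v x)‖ :=
          abs_real_inner_le_norm _ _
      _ ≤ W * (‖iteratedFDeriv ℝ 1 v x‖ * ‖curl v x‖) :=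
          mul_le_mul (hW x) hA (norm_nonneg _) hW0
      _ ≤ W * ((‖iteratedFDeriv ℝ 1 v x‖ ^ 2 + ‖curl v x‖ ^ 2) / 2) :=
          mul_le_mul_of_nonneg_left h2 hW0
      _ = W / 2 * (‖iteratedFDeriv ℝ 1 v x‖ ^ 2 + ‖curl v x‖ ^ 2) := by ring
  have hpt : ∀ x, ⟪curl v x, fderiv ℝ v x (curl v x)⟫_ℝ ≤
      W / 2 * (‖iteratedFDeriv ℝ 1 v x‖ ^ 2 + ‖curl v x‖ ^ 2) := fun x => (le_abs_self _).trans (hpt_abs x)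
  have hgint : Integrable (fun x => W / 2 * (‖iteratedFDeriv ℝ 1 v x‖ ^ 2 + ‖curl v x‖ ^ 2)) :=
    (hg.add hint).const_mul (W / 2)
  have hfint : Integrable (fun x => ⟪curl v x, fderiv ℝ v x (curl v x)⟫_ℝ) :=
    hgint.mono' hfc.aestronglyMeasurable (Eventually.of_forall fun x => by
      rw [Real.norm_eq_abs]; exact hpt_abs x)
  -- `∫‖Dv‖² ≤ ∫|curl v|²`
  have hA : ∫ x, ‖iteratedFDeriv ℝ 1 v x‖ ^ 2 ≤ ∫ x, ‖curl v x‖ ^ 2 := by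
    rw [integral_eq_lintegral_of_nonneg_ae (ae_of_all _ fun x => by positivity) hg.aestronglyMeasurable,
      integral_eq_lintegral_of_nonneg_ae (ae_of_all _ fun x => by positivity) hint.aestronglyMeasurable]
    refine ENNReal.toReal_mono hint.lintegral_lt_top.ne ?_
    calc ∫⁻ x, ENNReal.ofReal (‖iteratedFDeriv ℝ 1 v x‖ ^ 2)
        ≤ ∫⁻ x, ENNReal.ofReal (frobeniusNormSq (fderiv ℝ v x)) := lintegral_mono fun x =>
          ENNReal.ofReal_le_ofReal (by rw [norm_iteratedFDeriv_one]; exact opNorm_sq_le_frobeniusNormSq_fin3 _)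
      _ ≤ ∫⁻ x, ‖curl v x‖ₑ ^ 2 := lintegral_frobeniusNormSq_fderiv_le_lintegral_sq_norm_curl hv hdiv h0
      _ = ∫⁻ x, ENNReal.ofReal (‖curl v x‖ ^ 2) := lintegral_congr fun x => by
          rw [← ofReal_norm, ENNReal.ofReal_pow (norm_nonneg _)]
  have hZ0 : 0 ≤ ∫ x, ‖curl v x‖ ^ 2 := integral_nonneg fun x => by positivity
  calc ∫ x, ⟪curl v x, fderiv ℝ v x (curl v x)⟫_ℝ
      ≤ ∫ x, W / 2 * (‖iteratedFDeriv ℝ 1 v x‖ ^ 2 + ‖curl v x‖ ^ 2) := integral_mono hfint hgint hpt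
    _ = W / 2 * ((∫ x, ‖iteratedFDeriv ℝ 1 v x‖ ^ 2) + ∫ x, ‖curl v x‖ ^ 2) := by
        rw [integral_const_mul, integral_add hg hint]
    _ ≤ W / 2 * ((∫ x, ‖curl v x‖ ^ 2) + ∫ x, ‖curl v x‖ ^ 2) := by gcongr
    _ = W * ∫ x, ‖curl v x‖ ^ 2 := by ring

/-! ### §2 One solution, registered-stub currency -/

/-- **`‖curl u‖_∞ = o(Z²)` ⟹ pointwise efficiency decay (ONE solution).** Along a maximal smooth Leray–Hopf
rapidly-decaying-datum solution on `[0,T)`: if for every `δ > 0`, eventually as `t ↑ T`, `‖curl u(t,x)‖ ≤ δ·Z(t)²` for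
all `x` (`Z(t) = (∫⁻‖curl u(t)‖ₑ²).toReal`), then every budget triple `(Z, Pal, S)` (clauses of stmt-22995 verbatim)
satisfies, for every `ε > 0`, eventually `0 < Z ∧ 2S − 2ν·Pal ≤ ε Z³`. (`2S ≤ 2‖ω‖_∞ Z ≤ 2δZ³`, `δ = ε/2`; `Z ≥ 1`
late by stmt-22867.) [folklore] -/
theorem depletion_of_curl_small {c ν T : ℝ} (hν : 0 < ν) (hT : 0 < T)
    {u : ℝ → EuclideanSpace ℝ (Fin 3) → EuclideanSpace ℝ (Fin 3)} {p : ℝ → EuclideanSpace ℝ (Fin 3) → ℝ}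
    (hmax : IsMaximalSmoothSolution ν 0 u p T) (hLH : IsLerayHopfOn T ν 0 (u 0) u)
    (hdec : HasRapidSpatialDecay (u 0))
    (hsmall : ∀ δ : ℝ, 0 < δ → ∀ᶠ t in 𝓝[<] T, ∀ x,
      ‖curl (u t) x‖ ≤ δ * ((∫⁻ y, ‖curl (u t) y‖ₑ ^ 2).toReal) ^ 2)
    {Zr Pr Sr : ℝ → ℝ}
    (hZ : ∀ t ∈ Set.Ioo 0 T, ∫⁻ x, ‖curl (u t) x‖ₑ ^ 2 = ENNReal.ofReal (Zr t) ∧ 0 ≤ Zr t ∧ 0 ≤ Pr t ∧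
      Pr t = ∫ x, frobeniusNormSq (fderiv ℝ (curl (u t)) x) ∧
      Sr t = ∫ x, ⟪curl (u t) x, fderiv ℝ (u t) x (curl (u t) x)⟫_ℝ ∧
      HasDerivAt Zr (2 * Sr t - 2 * ν * Pr t) t ∧ |Sr t| ≤ c * Zr t ^ (3/4 : ℝ) * Pr t ^ (3/4 : ℝ))
    {ε : ℝ} (hε : 0 < ε) :
    ∃ t₁ ∈ Set.Ioo 0 T, ∀ t ∈ Set.Ico t₁ T, 0 < Zr t ∧ 2 * Sr t - 2 * ν * Pr t ≤ ε * Zr t ^ 3 := by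
  have hIoo : ∀ᶠ t in 𝓝[<] T, t ∈ Ioo 0 T := Ioo_mem_nhdsLT hT
  have hone : ∀ᶠ t in 𝓝[<] T, ENNReal.ofReal 1 ≤ ∫⁻ x, ‖curl (u t) x‖ₑ ^ 2 :=
    BlowupEnstrophyUnbounded.main hν hT hmax hLH hdec 1
  have hall := hIoo.and ((hsmall (ε / 2) (half_pos hε)).and hone)
  obtain ⟨T₁, hT₁T, hsub⟩ := mem_nhdsLT_iff_exists_Ioo_subset.1 hall
  set t₁ : ℝ := (max T₁ 0 + T) / 2 with ht₁
  have hm : max T₁ 0 < T := max_lt hT₁T hT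
  have ht₁I : t₁ ∈ Ioo 0 T := ⟨by rw [ht₁]; linarith [le_max_right T₁ 0], by rw [ht₁]; linarith⟩
  refine ⟨t₁, ht₁I, fun t ht => ?_⟩
  have hT₁t : T₁ < t := by
    have : max T₁ 0 < t₁ := by rw [ht₁]; linarith
    exact (le_max_left T₁ 0).trans_lt (this.trans_le ht.1)
  obtain ⟨htI, hcurl, hge⟩ := hsub ⟨hT₁t, ht.2⟩
  obtain ⟨hZeq, hZ0, hP0, -, hSeq, -, -⟩ := hZ t htI
  obtain ⟨hsm, hdiv, hsob, hZint⟩ := Violation.slice_data hν hT hmax hLH hdec htI hZeq hZ0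
  -- `Zr t ≥ 1`
  rw [hZeq] at hge
  have hZ1 : 1 ≤ Zr t := (ENNReal.ofReal_le_ofReal_iff hZ0).1 hge
  have hZpos : 0 < Zr t := one_pos.trans_le hZ1
  have hintr : (∫⁻ y, ‖curl (u t) y‖ₑ ^ 2).toReal = Zr t := by rw [hZeq, ENNReal.toReal_ofReal hZ0]
  have hcurl' : ∀ x, ‖curl (u t) x‖ ≤ ε / 2 * Zr t ^ 2 := fun x => by
    have h := hcurl x
    rwa [hintr] at h
  -- the slice is `L²`
  have h0 : ∫⁻ x, ‖u t x‖ₑ ^ 2 < ⊤ := by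
    refine lt_of_le_of_lt (le_of_eq (lintegral_congr fun x => ?_)) (hsob 0)
    rw [← ofReal_norm, ← ofReal_norm (iteratedFDeriv ℝ 0 (u t) x), norm_iteratedFDeriv_zero]
  have hS : Sr t ≤ ε / 2 * Zr t ^ 2 * Zr t := by
    have h := stretching_le_of_norm_curl_le (hsm.of_le (by norm_cast)) hdiv h0 (hsob 1) hcurl'
    rw [← hZint] at h
    rw [hSeq]
    exact h
  have hνP : 0 ≤ 2 * ν * Pr t := by positivity
  refine ⟨hZpos, ?_⟩
  calc 2 * Sr t - 2 * ν * Pr t ≤ 2 * Sr t := by linarith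
    _ ≤ 2 * (ε / 2 * Zr t ^ 2 * Zr t) := by linarith
    _ = ε * Zr t ^ 3 := by ring

/-! ### §3 One solution, crux currency -/

/-- **`‖curl u‖_∞ = o(Z²)` ⟹ the crux's ε-law (ONE solution)**: window `0 < Z < ⊤` and `Z(s)⁻² − Z(t)⁻² ≤ ε(t−s)` on
a late window, for every `ε > 0`. [folklore] -/
theorem efficiencyDecayLaw_of_curl_small {ν T : ℝ} (hν : 0 < ν) (hT : 0 < T)
    {u : ℝ → EuclideanSpace ℝ (Fin 3) → EuclideanSpace ℝ (Fin 3)} {p : ℝ → EuclideanSpace ℝ (Fin 3) → ℝ}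
    (hmax : IsMaximalSmoothSolution ν 0 u p T) (hLH : IsLerayHopfOn T ν 0 (u 0) u)
    (hdec : HasRapidSpatialDecay (u 0))
    (hsmall : ∀ δ : ℝ, 0 < δ → ∀ᶠ t in 𝓝[<] T, ∀ x,
      ‖curl (u t) x‖ ≤ δ * ((∫⁻ y, ‖curl (u t) y‖ₑ ^ 2).toReal) ^ 2) :
    ∀ ε : ℝ, 0 < ε → ∃ t₁ ∈ Set.Ico 0 T, (∀ t ∈ Set.Ico t₁ T,
        0 < ∫⁻ x, ‖curl (u t) x‖ₑ ^ 2 ∧ ∫⁻ x, ‖curl (u t) x‖ₑ ^ 2 < ⊤) ∧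
        ∀ s t : ℝ, t₁ ≤ s → s ≤ t → t < T →
          ((∫⁻ x, ‖curl (u s) x‖ₑ ^ 2).toReal)⁻¹ ^ 2 - ((∫⁻ x, ‖curl (u t) x‖ₑ ^ 2).toReal)⁻¹ ^ 2 ≤
            ε * (t - s) := by
  intro ε hε
  obtain ⟨c, _, hB⟩ := EnstrophyBudget.main
  obtain ⟨Zr, Pr, Sr, hZ⟩ := hB ν T hν hT u p hmax hLH hdec
  obtain ⟨t₁, ht₁, hdep⟩ := depletion_of_curl_small hν hT hmax hLH hdec hsmall hZ (half_pos hε)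
  have hIoo : ∀ t ∈ Ico t₁ T, t ∈ Ioo 0 T := fun t ht => ⟨ht₁.1.trans_le ht.1, ht.2⟩
  have hpos : ∀ t ∈ Ico t₁ T, 0 < Zr t := fun t ht => (hdep t ht).1
  have hder : ∀ t ∈ Ico t₁ T, ∃ D : ℝ, HasDerivAt Zr D t ∧ D ≤ ε / 2 * Zr t ^ 3 := fun t ht =>
    ⟨2 * Sr t - 2 * ν * Pr t, (hZ t (hIoo t ht)).2.2.2.2.2.1, (hdep t ht).2⟩
  refine ⟨t₁, ⟨ht₁.1.le, ht₁.2⟩, fun t ht => ?_, fun s t hs hst htT => ?_⟩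
  · rw [(hZ t (hIoo t ht)).1]
    exact ⟨ENNReal.ofReal_pos.2 (hpos t ht), ENNReal.ofReal_lt_top⟩
  · have hsI : s ∈ Ico t₁ T := ⟨hs, hst.trans_lt htT⟩
    have htI : t ∈ Ico t₁ T := ⟨hs.trans hst, htT⟩
    rw [(hZ s (hIoo s hsI)).1, (hZ t (hIoo t htI)).1, ENNReal.toReal_ofReal (hpos s hsI).le,
      ENNReal.toReal_ofReal (hpos t htI).le]
    have h := ProductionEfficiencyDecay.stub_integrateEfficiency Zr t₁ T (ε / 2) hpos hder s t hs hst htT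
    linarith

/-! ### §4 By name -/

/-- **The vorticity criterion along every first blow-up ⟹ the registered crux-proper stub S2** (signature of
`stub_depletionGivenBudget` VERBATIM as the conclusion). Implication between statements about hypothetical blow-ups;
the stub is NOT closed. [folklore] -/
theorem stub_depletionGivenBudget_of_curl_small
    (hV : ∀ (ν T : ℝ), 0 < ν → 0 < T → ∀ (u : ℝ → EuclideanSpace ℝ (Fin 3) → EuclideanSpace ℝ (Fin 3)) (p : ℝ →
      EuclideanSpace ℝ (Fin 3) → ℝ), Literature.Analysis.FluidPDE.IsMaximalSmoothSolution ν 0 u p T →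
      Literature.Analysis.FluidPDE.IsLerayHopfOn T ν 0 (u 0) u → Literature.Analysis.FluidPDE.HasRapidSpatialDecay
      (u 0) → ∀ δ : ℝ, 0 < δ → ∀ᶠ t in nhdsWithin T (Set.Iio T), ∀ x,
      ‖Literature.Analysis.FluidPDE.curl (u t) x‖ ≤
        δ * ((∫⁻ y, ‖Literature.Analysis.FluidPDE.curl (u t) y‖ₑ ^ 2).toReal) ^ 2) :
    ∀ (c ν T : ℝ), 0 < c → 0 < ν → 0 < T → ∀ (u : ℝ → EuclideanSpace ℝ (Fin 3) → EuclideanSpace ℝ (Fin 3)) (p : ℝ → EuclideanSpace ℝ (Fin 3) → ℝ), Literature.Analysis.FluidPDE.IsMaximalSmoothSolution ν 0 u p T → Literature.Analysis.FluidPDE.IsLerayHopfOn T ν 0 (u 0) u → Literature.Analysis.FluidPDE.HasRapidSpatialDecay (u 0) → ∀ (Zr Pr Sr : ℝ → ℝ), (∀ t ∈ Set.Ioo 0 T, ∫⁻ x, ‖Literature.Analysis.FluidPDE.curl (u t) x‖ₑ ^ 2 = ENNReal.ofReal (Zr t) ∧ 0 ≤ Zr t ∧ 0 ≤ Pr t ∧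 Pr t = ∫ x, Literature.Analysis.FluidPDE.frobeniusNormSq (fderiv ℝ (Literature.Analysis.FluidPDE.curl (u t)) x) ∧ Sr t = ∫ x, ⟪Literature.Analysis.FluidPDE.curl (u t) x, fderiv ℝ (u t) x (Literature.Analysis.FluidPDE.curl (u t) x)⟫_ℝ ∧ HasDerivAt Zr (2 * Sr t - 2 * ν * Pr t) t ∧ |Sr t| ≤ c * Zr t ^ (3/4 : ℝ) * Pr t ^ (3/4 : ℝ)) → ∀ ε : ℝ, 0 < ε → ∃ t₁ ∈ Set.Ioo 0 T, ∀ t ∈ Set.Ico t₁ T, 0 < Zr t ∧ 2 * Sr t - 2 * ν * Pr t ≤ ε * Zr t ^ 3 :=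
  fun _c ν T _hc hν hT u p hmax hLH hdec _Zr _Pr _Sr hZ _ε hε =>
    depletion_of_curl_small hν hT hmax hLH hdec (hV ν T hν hT u p hmax hLH hdec) hZ hε

/-- **The vorticity criterion along every first blow-up ⟹ the crux `ProductionEfficiencyDecay`, BY NAME.**
Implication between statements about hypothetical blow-ups; the crux is NOT proved. [folklore] -/
theorem productionEfficiencyDecay_of_curl_small
    (hV : ∀ (ν T : ℝ), 0 < ν → 0 < T → ∀ (u : ℝ → EuclideanSpace ℝ (Fin 3) → EuclideanSpace ℝ (Fin 3)) (p : ℝ →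
      EuclideanSpace ℝ (Fin 3) → ℝ), Literature.Analysis.FluidPDE.IsMaximalSmoothSolution ν 0 u p T →
      Literature.Analysis.FluidPDE.IsLerayHopfOn T ν 0 (u 0) u → Literature.Analysis.FluidPDE.HasRapidSpatialDecay
      (u 0) → ∀ δ : ℝ, 0 < δ → ∀ᶠ t in nhdsWithin T (Set.Iio T), ∀ x,
      ‖Literature.Analysis.FluidPDE.curl (u t) x‖ ≤
        δ * ((∫⁻ y, ‖Literature.Analysis.FluidPDE.curl (u t) y‖ₑ ^ 2).toReal) ^ 2) :
    Summit.NavierStokesRegularity.NavierStokesRegularity.Theses.EfficiencyFloor.ProductionEfficiencyDecay := by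
  intro ν T hν hT u p hmax hLH hdec ε hε
  exact efficiencyDecayLaw_of_curl_small hν hT hmax hLH hdec (hV ν T hν hT u p hmax hLH hdec) ε hε

/-! ### §5 The gradient criterion and the Type-I stratum factor through the vorticity criterion -/

/-- **Gradient criterion ⟹ vorticity criterion** (`|curl v| ≤ ‖curlCLM‖ · ‖∇v‖`, `norm_curl_le`): for any field
`u` on `[0,T)`, `‖∇u(t)‖_∞ = o(Z²)` implies `‖curl u(t)‖_∞ = o(Z²)`. [folklore] -/
theorem curl_small_of_fderiv_small {T : ℝ} {u : ℝ → EuclideanSpace ℝ (Fin 3) → EuclideanSpace ℝ (Fin 3)}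
    (hsmall : ∀ δ : ℝ, 0 < δ → ∀ᶠ t in 𝓝[<] T, ∀ x,
      ‖fderiv ℝ (u t) x‖ ≤ δ * ((∫⁻ y, ‖curl (u t) y‖ₑ ^ 2).toReal) ^ 2) :
    ∀ δ : ℝ, 0 < δ → ∀ᶠ t in 𝓝[<] T, ∀ x,
      ‖curl (u t) x‖ ≤ δ * ((∫⁻ y, ‖curl (u t) y‖ₑ ^ 2).toReal) ^ 2 := by
  intro δ hδ
  set κ : ℝ := ‖(Literature.Analysis.FluidPDE.curlCLM :
    (EuclideanSpace ℝ (Fin 3) →L[ℝ] EuclideanSpace ℝ (Fin 3)) →L[ℝ] EuclideanSpace ℝ (Fin 3))‖ with hκ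
  have hκ0 : 0 ≤ κ := by
    rw [hκ]
    exact norm_nonneg (Literature.Analysis.FluidPDE.curlCLM :
      (EuclideanSpace ℝ (Fin 3) →L[ℝ] EuclideanSpace ℝ (Fin 3)) →L[ℝ] EuclideanSpace ℝ (Fin 3))
  have hδ' : 0 < δ / (κ + 1) := div_pos hδ (by positivity)
  filter_upwards [hsmall (δ / (κ + 1)) hδ'] with t ht x
  have hZ0 : 0 ≤ ((∫⁻ y, ‖curl (u t) y‖ₑ ^ 2).toReal) ^ 2 := sq_nonneg _
  calc ‖curl (u t) x‖ ≤ κ * ‖fderiv ℝ (u t) x‖ := norm_curl_le (u t) x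
    _ ≤ κ * (δ / (κ + 1) * ((∫⁻ y, ‖curl (u t) y‖ₑ ^ 2).toReal) ^ 2) :=
        mul_le_mul_of_nonneg_left (ht x) hκ0
    _ = (κ / (κ + 1)) * δ * ((∫⁻ y, ‖curl (u t) y‖ₑ ^ 2).toReal) ^ 2 := by ring
    _ ≤ 1 * δ * ((∫⁻ y, ‖curl (u t) y‖ₑ ^ 2).toReal) ^ 2 := by
        gcongr
        exact (div_le_one (by positivity)).2 (by linarith)
    _ = δ * ((∫⁻ y, ‖curl (u t) y‖ₑ ^ 2).toReal) ^ 2 := by ring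

/-- **Velocity Type I + super-Leray floor ⟹ the vorticity criterion** (KNSS vorticity rate `|curl u(t)| ≤ C/(T−t)`,
`LambBudget.vorticityTypeI_of_gradientTypeI ∘ gradientTypeIOfTypeI`, and the floor with `K = √(C⁺/δ)`): so
`…TypeIStratum.depletion_of_isTypeIBlowup_of_floor` is `depletion_of_curl_small` on the Type-I stratum.
[cite: KochNadirashviliSereginSverak2009, §4 (4.10)] -/
theorem curl_small_of_isTypeIBlowup_of_floor {ν T : ℝ} (hν : 0 < ν) (hT : 0 < T)
    {u : ℝ → EuclideanSpace ℝ (Fin 3) → EuclideanSpace ℝ (Fin 3)} {p : ℝ → EuclideanSpace ℝ (Fin 3) → ℝ}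
    (hmax : IsMaximalSmoothSolution ν 0 u p T) (hLH : IsLerayHopfOn T ν 0 (u 0) u)
    (hdec : HasRapidSpatialDecay (u 0)) (hI : IsTypeIBlowup u T)
    (hfloor : ∀ K : ℝ, ∀ᶠ t in 𝓝[<] T, ENNReal.ofReal (K / Real.sqrt (T - t)) < ∫⁻ x, ‖curl (u t) x‖ₑ ^ 2) :
    ∀ δ : ℝ, 0 < δ → ∀ᶠ t in 𝓝[<] T, ∀ x,
      ‖curl (u t) x‖ ≤ δ * ((∫⁻ y, ‖curl (u t) y‖ₑ ^ 2).toReal) ^ 2 := by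
  intro δ hδ
  obtain ⟨C, hC⟩ := EnstrophyQuarterLaw.LambBudget.vorticityTypeI_of_gradientTypeI
    (EnstrophyQuarterLaw.LambBudget.gradientTypeIOfTypeI ν T hν hT u p hmax hLH hdec hI)
  set Cp : ℝ := max C 0 with hCp
  have hCp0 : 0 ≤ Cp := le_max_right _ _
  have hCCp : C ≤ Cp := le_max_left _ _
  set K : ℝ := Real.sqrt (Cp / δ) with hK
  have hK0 : 0 ≤ K := Real.sqrt_nonneg _
  have hK2 : K ^ 2 = Cp / δ := by rw [hK, Real.sq_sqrt (by positivity)]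
  obtain ⟨c, _, hB⟩ := EnstrophyBudget.main
  obtain ⟨Zr, Pr, Sr, hZ⟩ := hB ν T hν hT u p hmax hLH hdec
  have hIoo : ∀ᶠ t in 𝓝[<] T, t ∈ Ioo 0 T := Ioo_mem_nhdsLT hT
  filter_upwards [hIoo, hC, hfloor K] with t htI hcurl hfl x
  have hTt : 0 < T - t := sub_pos.2 htI.2
  obtain ⟨hZeq, hZ0, -⟩ := hZ t htI
  rw [hZeq, ENNReal.ofReal_lt_ofReal_iff'] at hfl
  rw [hZeq, ENNReal.toReal_ofReal hZ0]
  have hKZ : K / Real.sqrt (T - t) < Zr t := hfl.1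
  have hsq : Cp / (T - t) < δ * Zr t ^ 2 := by
    have h1 : (K / Real.sqrt (T - t)) ^ 2 < Zr t ^ 2 :=
      pow_lt_pow_left₀ hKZ (div_nonneg hK0 (Real.sqrt_nonneg _)) two_ne_zero
    have h2 : (K / Real.sqrt (T - t)) ^ 2 = Cp / δ / (T - t) := by
      rw [div_pow, Real.sq_sqrt hTt.le, hK2]
    rw [h2] at h1
    have h3 : Cp / δ / (T - t) = (Cp / (T - t)) / δ := by ring
    rw [h3, div_lt_iff₀ hδ] at h1
    linarith
  calc ‖curl (u t) x‖ ≤ C / (T - t) := hcurl x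
    _ ≤ Cp / (T - t) := div_le_div_of_nonneg_right hCCp hTt.le
    _ ≤ δ * Zr t ^ 2 := hsq.le

/-! ### §6 Instant-wise dual: where the efficiency law fails, the vorticity maximum dominates `Z²`

(Appended.) The contrapositive of §1 at ONE instant, with no smallness hypothesis: at an `ε`-VIOLATION TIME
(`ε Z³ < 2S − 2ν·Pal`, as in `…ViolationStructure`) some point carries vorticity `|curl u(t,x)| > (ε/2)·Z(t)²`; with
Leray's floor `Z(t) ≥ c_L ν^{3/2}/√(T−t)` (`Violation.leray_floor_real`) this is an explicit BKM-type amplitude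
`|curl u(t,x)| > (ε c_L² ν³/2)/(T−t)` at every violation instant — complementing the parabolic CONCENTRATION of
`…ViolationStructure` §3 with an AMPLITUDE statement. Nothing asserts that violation instants occur. -/

/-- **At an `ε`-violation instant the vorticity maximum exceeds `(ε/2)·Z²`.** Along a maximal smooth Leray–Hopf
rapidly-decaying-datum solution with budget triple `(Z, Pal, S)` (clauses of stmt-22995 verbatim), at every
`t ∈ (0,T)` with `ε Z(t)³ < 2S(t) − 2ν·Pal(t)` there is a point `x` with `(ε/2)·Z(t)² < ‖curl u(t,x)‖` (else §1 gives
`2S − 2ν·Pal ≤ ε Z³`). [folklore] -/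
theorem exists_norm_curl_gt_of_violation {c ν T : ℝ} (hν : 0 < ν) (hT : 0 < T)
    {u : ℝ → EuclideanSpace ℝ (Fin 3) → EuclideanSpace ℝ (Fin 3)} {p : ℝ → EuclideanSpace ℝ (Fin 3) → ℝ}
    (hmax : IsMaximalSmoothSolution ν 0 u p T) (hLH : IsLerayHopfOn T ν 0 (u 0) u)
    (hdec : HasRapidSpatialDecay (u 0)) {Zr Pr Sr : ℝ → ℝ}
    (hZ : ∀ t ∈ Set.Ioo 0 T, ∫⁻ x, ‖curl (u t) x‖ₑ ^ 2 = ENNReal.ofReal (Zr t) ∧ 0 ≤ Zr t ∧ 0 ≤ Pr t ∧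
      Pr t = ∫ x, frobeniusNormSq (fderiv ℝ (curl (u t)) x) ∧
      Sr t = ∫ x, ⟪curl (u t) x, fderiv ℝ (u t) x (curl (u t) x)⟫_ℝ ∧
      HasDerivAt Zr (2 * Sr t - 2 * ν * Pr t) t ∧ |Sr t| ≤ c * Zr t ^ (3/4 : ℝ) * Pr t ^ (3/4 : ℝ))
    {t : ℝ} (ht : t ∈ Set.Ioo 0 T) {ε : ℝ} (hviol : ε * Zr t ^ 3 < 2 * Sr t - 2 * ν * Pr t) :
    ∃ x, ε / 2 * Zr t ^ 2 < ‖curl (u t) x‖ := by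
  by_contra hcon
  simp only [not_exists, not_lt] at hcon
  obtain ⟨hZeq, hZ0, hP0, -, hSeq, -, -⟩ := hZ t ht
  obtain ⟨hsm, hdiv, hsob, hZint⟩ := Violation.slice_data hν hT hmax hLH hdec ht hZeq hZ0
  have h0 : ∫⁻ x, ‖u t x‖ₑ ^ 2 < ⊤ := by
    refine lt_of_le_of_lt (le_of_eq (lintegral_congr fun x => ?_)) (hsob 0)
    rw [← ofReal_norm, ← ofReal_norm (iteratedFDeriv ℝ 0 (u t) x), norm_iteratedFDeriv_zero]
  have hS : Sr t ≤ ε / 2 * Zr t ^ 2 * Zr t := by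
    have h := stretching_le_of_norm_curl_le (hsm.of_le (by norm_cast)) hdiv h0 (hsob 1) hcon
    rw [← hZint] at h
    rw [hSeq]
    exact h
  have hνP : 0 ≤ 2 * ν * Pr t := by positivity
  have : 2 * Sr t - 2 * ν * Pr t ≤ ε * Zr t ^ 3 := by
    calc 2 * Sr t - 2 * ν * Pr t ≤ 2 * Sr t := by linarith
      _ ≤ 2 * (ε / 2 * Zr t ^ 2 * Zr t) := by linarith
      _ = ε * Zr t ^ 3 := by ring
  linarith

/-- **At an `ε`-violation instant the vorticity maximum is at the BKM rate with an explicit constant**: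
`(ε c_L² ν³ / 2)/(T−t) < ‖curl u(t,x)‖` for some `x`, where `c_L > 0` is the universal Leray constant of
`Violation.leray_floor_real` (`Z(t) ≥ c_L ν^{3/2}/√(T−t)` on `(0,T)`), for `ε ≥ 0`. [folklore] -/
theorem exists_norm_curl_gt_rate_of_violation :
    ∃ cL : ℝ, 0 < cL ∧ ∀ (c ν T : ℝ), 0 < ν → 0 < T →
      ∀ (u : ℝ → EuclideanSpace ℝ (Fin 3) → EuclideanSpace ℝ (Fin 3)) (p : ℝ → EuclideanSpace ℝ (Fin 3) → ℝ),
        IsMaximalSmoothSolution ν 0 u p T → IsLerayHopfOn T ν 0 (u 0) u → HasRapidSpatialDecay (u 0) →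
        ∀ (Zr Pr Sr : ℝ → ℝ),
          (∀ t ∈ Set.Ioo 0 T, ∫⁻ x, ‖curl (u t) x‖ₑ ^ 2 = ENNReal.ofReal (Zr t) ∧ 0 ≤ Zr t ∧ 0 ≤ Pr t ∧
            Pr t = ∫ x, frobeniusNormSq (fderiv ℝ (curl (u t)) x) ∧
            Sr t = ∫ x, ⟪curl (u t) x, fderiv ℝ (u t) x (curl (u t) x)⟫_ℝ ∧
            HasDerivAt Zr (2 * Sr t - 2 * ν * Pr t) t ∧ |Sr t| ≤ c * Zr t ^ (3/4 : ℝ) * Pr t ^ (3/4 : ℝ)) →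
          ∀ t ∈ Set.Ioo 0 T, ∀ ε : ℝ, 0 ≤ ε → ε * Zr t ^ 3 < 2 * Sr t - 2 * ν * Pr t →
            ∃ x, ε * cL ^ 2 * ν ^ 3 / 2 / (T - t) < ‖curl (u t) x‖ := by
  obtain ⟨cL, hcL, hfloor⟩ := Violation.leray_floor_real
  refine ⟨cL, hcL, ?_⟩
  intro c ν T hν hT u p hmax hLH hdec Zr Pr Sr hZ t ht ε hε hviol
  obtain ⟨x, hx⟩ := exists_norm_curl_gt_of_violation hν hT hmax hLH hdec hZ ht hviol
  refine ⟨x, lt_of_le_of_lt ?_ hx⟩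
  have hTt : 0 < T - t := sub_pos.2 ht.2
  have hfl := hfloor ν T hν hT u p hmax hLH hdec Zr (fun s hs => ⟨(hZ s hs).1, (hZ s hs).2.1⟩) t ht
  -- square Leray's floor: `cL² ν³ / (T−t) ≤ Zr t ²`
  have hL0 : 0 ≤ cL * ν ^ (3 / 2 : ℝ) * (T - t) ^ (-(1 / 2 : ℝ)) := by positivity
  have hsq : (cL * ν ^ (3 / 2 : ℝ) * (T - t) ^ (-(1 / 2 : ℝ))) ^ 2 = cL ^ 2 * ν ^ 3 / (T - t) := by
    have h1 : (ν ^ (3 / 2 : ℝ)) ^ 2 = ν ^ 3 := by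
      rw [← Real.rpow_natCast, ← Real.rpow_mul hν.le]
      norm_num
    have h2 : ((T - t) ^ (-(1 / 2 : ℝ))) ^ 2 = (T - t)⁻¹ := by
      rw [← Real.rpow_natCast, ← Real.rpow_mul hTt.le]
      norm_num
      exact Real.rpow_neg_one (T - t)
    rw [mul_pow, mul_pow, h1, h2, div_eq_mul_inv]
  have hZ2 : cL ^ 2 * ν ^ 3 / (T - t) ≤ Zr t ^ 2 := by
    rw [← hsq]
    exact pow_le_pow_left₀ hL0 hfl 2
  have hε2 : 0 ≤ ε / 2 := by linarith
  calc ε * cL ^ 2 * ν ^ 3 / 2 / (T - t) = ε / 2 * (cL ^ 2 * ν ^ 3 / (T - t)) := by ring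
    _ ≤ ε / 2 * Zr t ^ 2 := mul_le_mul_of_nonneg_left hZ2 hε2

end VorticityCriterion

end ProductionEfficiencyDecay

end Summit.NavierStokesRegularity.NavierStokesRegularity.Theorems

end
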